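import Mathlib.Algebra.Group.TypeTags.Basic
import Mathlib.GroupTheory.OrderOfElement
import Literature.IUT.HodgeArakelov.MonoThetaProp13Sub
import Literature.IUT.HodgeArakelov.TemperedThetaMonoidsWitness

/-!
# [IUTchII] Prop 1.3 (iii) sub-nodes r4a/r4b and Example 3.2 AS TYPED: universal closures classified

S. Mochizuki, *Inter-universal Teichmüller theory II*, §1, Proposition 1.3 (ii)/(iii), kurims manuscript
(Dec. 2020) p. 26 (statement of (ii): the two "correspondences of notation" `μ_N(S) ↔ μ_Ẑ(M_TM) ⊗ ℤ/Nℤ`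
and `(l·Δ_Θ)_S ⊗ ℤ/Nℤ ↔ μ_Ẑ(Π_X) ⊗ ℤ/Nℤ`) and p. 27 l. 1–7 (proof of (iii)); §3, Example 3.2 (i)/(ii)
pp. 88–89 (`Ψ_{F^Θ_v,α} := O^×_{C^Θ_v}(A^Θ_∞)·(Θ^α_v)^ℕ`, "characteristic splittings up to torsion").
Record-only under the claim key `Mochizuki2012` (D-0012, disputed). PROOF-ONLY file (abc-iut cell,
WAVE-5 seat abc-iut-w5-d076 gen 6, F-TRANCHES tranche 185; rows F-2782 `Prop13Sub.CorrMuNConventional`,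
F-2783 `Prop13Sub.CorrIntSConventional`, F-2568 `TemperedThetaMonoids.Example32Statements`): no definition
lands, no typed statement is edited or restated.

The three rows are PREDICATES ON A BINDER, not closed facts, and this file records the kernel events that
classify them (FACT-LIST rule R5, «admissible at named instances only»):

* r4a/r4b (abc-iut-w5-d064's sub-nodes of the printed proof of Prop. 1.3 (iii), typed over the binder
  `κ : Prop13Sub.ConventionalCyclotomes Z B ν` = "the conventional identification between the cyclotomes
  involved that arises from conventional scheme theory", p. 27 l. 5–7). KERNEL CHARACTERISATION: each clause
  pins exactly one field of `κ` in terms of another and of the typed Prop. 1.3 (ii) data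
  (`corrMuNConventional_iff : CorrMuNConventional κ ↔ κ.idMuN = B.corr_muN.trans κ.idMTM`,
  `corrIntSConventional_iff : CorrIntSConventional κ ↔ κ.idIntS = B.corr_intS.trans κ.idPiX`); re-gauging
  that field by any automorphism `φ ≠ 1` of the reference cyclotome `ν` destroys the clause
  (`not_corrMuNConventional_regauge`, `not_corrIntSConventional_regauge`); hence the UNIVERSAL CLOSURE over
  `κ` holds at a datum `(Z, B, ν)` IFF the binder type is empty or `ν` has no non-identity automorphism
  (`forall_corrMuNConventional_iff`, `forall_corrIntSConventional_iff`) — i.e. never at arithmetic data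
  (`μ_N`, `N ≥ 3`, has the automorphism `ζ ↦ ζ⁻¹ ≠ id`). The INSTANCE form at the tautological `κ` is the
  typer's `Prop13Sub.subnodes_ofBsGal` (cited by name, re-exported as exact-name witnesses
  `corrMuNConventional_ofBsGal`, `corrIntSConventional_ofBsGal`). Reading: the rows are constraints on the
  datum `κ` whose content is the PINNING of `κ` to [EtTh] §1 / [AbsTopIII] §1, §3 (owners L2, L4) — exactly
  the typer's own docstring «OPEN sub-node … NOT a FACT-LIST fact».
* Example 3.2 (abc-iut-L6-t2's `Prop`-structure `Example32Statements F` over the INPUT interface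
  `F : TemperedFrobenioidThetaData P`). UNIVERSAL CLOSURE REFUTED (`not_forall_example32Statements`): at the
  junk datum «`Θ` a non-torsion UNIT» (`K = ℤ` written multiplicatively, trivial action, units `= ⊤`,
  `Θ := 1 ∈ ℤ`) the splitting clause of Ex. 3.2 (i) fails, since `Θ ∈ O^× ∩ Θ^{ℚ≥0}` is not torsion; by the
  typer lineage's `example32Statements_iff_id` the structure is equivalent to that clause. INSTANCE form:
  abc-iut-L6-d3's `example32Statements_witness` / L6-t2's `example32Statements_of_val` (non-degenerate data
  with a valuation killing the units and positive on `Θ`), cited by name. Reading: Ex. 3.2 holds exactly for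
  inputs where `Θ_v` is a non-unit modulo torsion — the printed situation (`Θ_v` has a pole) — so the row
  is a hypothesis on the input datum, supplied by [IUTchI] Ex. 3.2 at the genuine tempered Frobenioid.

HONEST FRAMING: a refuted universal closure says the typed row is a hypothesis on data, not that anything in
print is false; nothing here bears on [IUTchIII] Cor. 3.12 (no side taken); typed ≠ proved.
-/

namespace Literature.IUT.HodgeArakelov

universe u w

open CategoryTheory
open Literature.AnabelianGeometry.EtaleTheta

/-! ## r4a / r4b: the correspondences of notation of Prop. 1.3 (ii) «are conventional» -/

namespace Prop13Sub

variable {S : ThetaSetting.{u}} {F : TemperedFrobenioidData S} {E : EnvOfFrobenioid F}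
  {Z : FrobenioidCyclotomes E} {B : BsGalData Z} {ν : Type w} [Group ν]

/-- **r4a characterised** ([IUTchII] Prop. 1.3 (ii) p. 26, «`μ_N(S)` corresponds to `μ_Ẑ(M_TM) ⊗ (ℤ/Nℤ)`»,
read as conventional under `κ`): the clause holds iff the field `κ.idMuN` IS the composite
`μ_N(S) →[corr_muN] μ_Ẑ(M_TM) ⊗ ℤ/Nℤ →[κ.idMTM] ν` — it pins one field of the binder `κ`.
[claim: Mochizuki2012, status: disputed] (IUTchII §1 Prop 1.3 (ii), kurims p.26) -/
theorem corrMuNConventional_iff (κ : ConventionalCyclotomes Z B ν) :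
    CorrMuNConventional κ ↔ κ.idMuN = B.corr_muN.trans κ.idMTM := by
  constructor
  · intro h
    ext u
    rw [MulEquiv.trans_apply]
    exact (h u).symm
  · intro h u
    rw [h, MulEquiv.trans_apply]

/-- **r4b characterised** ([IUTchII] Prop. 1.3 (ii) p. 26, «`(l·Δ_Θ)_S ⊗ (ℤ/Nℤ)` corresponds to
`μ_Ẑ(Π_X) ⊗ (ℤ/Nℤ)`», read as conventional under `κ`): the clause holds iff `κ.idIntS` IS the composite
`(l·Δ_Θ)_S ⊗ ℤ/Nℤ →[corr_intS] μ_Ẑ(Π_X) ⊗ ℤ/Nℤ →[κ.idPiX] ν`.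
[claim: Mochizuki2012, status: disputed] (IUTchII §1 Prop 1.3 (ii), kurims p.26) -/
theorem corrIntSConventional_iff (κ : ConventionalCyclotomes Z B ν) :
    CorrIntSConventional κ ↔ κ.idIntS = B.corr_intS.trans κ.idPiX := by
  constructor
  · intro h
    ext x
    rw [MulEquiv.trans_apply]
    exact (h x).symm
  · intro h x
    rw [h, MulEquiv.trans_apply]

/-- **Exact-name instance witness for F-2782** (r4a at the tautological `κ := ConventionalCyclotomes.ofBsGal B`,
abc-iut-w5-d064's `subnodes_ofBsGal`, third conjunct): the clause is inhabited at every typed Prop. 1.3 (ii)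
datum. [claim: Mochizuki2012, status: disputed] (IUTchII §1 Prop 1.3 (ii), kurims p.26) -/
theorem corrMuNConventional_ofBsGal (B : BsGalData Z) :
    CorrMuNConventional (ConventionalCyclotomes.ofBsGal B) :=
  (subnodes_ofBsGal B).2.2.1

/-- **Exact-name instance witness for F-2783** (r4b at the tautological `κ := ConventionalCyclotomes.ofBsGal B`,
abc-iut-w5-d064's `subnodes_ofBsGal`, fourth conjunct). [claim: Mochizuki2012, status: disputed]
(IUTchII §1 Prop 1.3 (ii), kurims p.26) -/
theorem corrIntSConventional_ofBsGal (B : BsGalData Z) :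
    CorrIntSConventional (ConventionalCyclotomes.ofBsGal B) :=
  (subnodes_ofBsGal B).2.2.2

/-- **Re-gauging kills r4a**: if `κ` satisfies r4a, then the binder obtained from `κ` by composing the
identification `κ.idMuN : μ_N(S) ⥲ ν` with an automorphism `φ ≠ 1` of the reference cyclotome `ν` (all other
identifications unchanged) violates r4a. So r4a is a constraint on `κ`, not a property of the datum
`(Z, B)`. [claim: Mochizuki2012, status: disputed] (IUTchII §1 Prop 1.3 (ii)/(iii), kurims pp.26–27) -/
theorem not_corrMuNConventional_regauge (κ : ConventionalCyclotomes Z B ν) (hκ : CorrMuNConventional κ)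
    (φ : ν ≃* ν) (hφ : φ ≠ MulEquiv.refl ν) :
    ¬ CorrMuNConventional { κ with idMuN := κ.idMuN.trans φ } := by
  intro h
  apply hφ
  ext y
  obtain ⟨u, rfl⟩ := κ.idMuN.surjective y
  have h1 := h u
  have h2 := hκ u
  -- `h1 : κ.idMTM (B.corr_muN u) = (κ.idMuN.trans φ) u`, `h2 : κ.idMTM (B.corr_muN u) = κ.idMuN u`
  simp only [MulEquiv.trans_apply] at h1
  rw [MulEquiv.refl_apply]
  exact h1.symm.trans h2

/-- **Re-gauging kills r4b** (same statement for the identification `κ.idIntS : (l·Δ_Θ)_S ⊗ ℤ/Nℤ ⥲ ν`).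
[claim: Mochizuki2012, status: disputed] (IUTchII §1 Prop 1.3 (ii)/(iii), kurims pp.26–27) -/
theorem not_corrIntSConventional_regauge (κ : ConventionalCyclotomes Z B ν) (hκ : CorrIntSConventional κ)
    (φ : ν ≃* ν) (hφ : φ ≠ MulEquiv.refl ν) :
    ¬ CorrIntSConventional { κ with idIntS := κ.idIntS.trans φ } := by
  intro h
  apply hφ
  ext y
  obtain ⟨x, rfl⟩ := κ.idIntS.surjective y
  have h1 := h x
  have h2 := hκ x
  simp only [MulEquiv.trans_apply] at h1
  rw [MulEquiv.refl_apply]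
  exact h1.symm.trans h2

/-- **Universal closure of r4a over the binder, classified**: at a typed Prop. 1.3 (i)(ii) datum `(Z, B)` and a
reference cyclotome `ν`, «every conventional-identification datum `κ` satisfies r4a» holds IFF there is no such
`κ` at all or `ν` admits no automorphism other than the identity. In particular it FAILS at every datum
with a binder and a reference cyclotome `μ_N`, `N ≥ 3` (inversion is a non-identity automorphism): the row
F-2782 is admissible at named instances `κ` only (rule R5), its content being the pinning of `κ` to scheme
theory (owners L2/L4), as the typer's docstring says. [claim: Mochizuki2012, status: disputed]
(IUTchII §1 Prop 1.3 (ii)/(iii), kurims pp.26–27) -/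
theorem forall_corrMuNConventional_iff :
    (∀ κ : ConventionalCyclotomes Z B ν, CorrMuNConventional κ) ↔
      (IsEmpty (ConventionalCyclotomes Z B ν) ∨ ∀ φ : ν ≃* ν, φ = MulEquiv.refl ν) := by
  constructor
  · intro h
    by_cases hne : Nonempty (ConventionalCyclotomes Z B ν)
    · obtain ⟨κ⟩ := hne
      refine Or.inr fun φ => ?_
      by_contra hφ
      exact not_corrMuNConventional_regauge κ (h κ) φ hφ (h _)
    · exact Or.inl (not_nonempty_iff.mp hne)
  · rintro (h | h) κ
    · exact (IsEmpty.false κ).elim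
    · rw [corrMuNConventional_iff]
      -- the discrepancy `(corr_muN ≫ idMTM)⁻¹ ≫ idMuN` is an automorphism of `ν`, hence the identity
      have hχ := h ((B.corr_muN.trans κ.idMTM).symm.trans κ.idMuN)
      ext u
      have this : κ.idMuN ((B.corr_muN.trans κ.idMTM).symm ((B.corr_muN.trans κ.idMTM) u)) =
          (B.corr_muN.trans κ.idMTM) u :=
        MulEquiv.congr_fun hχ _
      rw [MulEquiv.symm_apply_apply, MulEquiv.trans_apply] at this
      rw [MulEquiv.trans_apply]
      exact this

/-- **Universal closure of r4b over the binder, classified** (same shape as `forall_corrMuNConventional_iff`;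
row F-2783 admissible at named instances only). [claim: Mochizuki2012, status: disputed]
(IUTchII §1 Prop 1.3 (ii)/(iii), kurims pp.26–27) -/
theorem forall_corrIntSConventional_iff :
    (∀ κ : ConventionalCyclotomes Z B ν, CorrIntSConventional κ) ↔
      (IsEmpty (ConventionalCyclotomes Z B ν) ∨ ∀ φ : ν ≃* ν, φ = MulEquiv.refl ν) := by
  constructor
  · intro h
    by_cases hne : Nonempty (ConventionalCyclotomes Z B ν)
    · obtain ⟨κ⟩ := hne
      refine Or.inr fun φ => ?_
      by_contra hφ
      exact not_corrIntSConventional_regauge κ (h κ) φ hφ (h _)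
    · exact Or.inl (not_nonempty_iff.mp hne)
  · rintro (h | h) κ
    · exact (IsEmpty.false κ).elim
    · rw [corrIntSConventional_iff]
      have hχ := h ((B.corr_intS.trans κ.idPiX).symm.trans κ.idIntS)
      ext x
      have this : κ.idIntS ((B.corr_intS.trans κ.idPiX).symm ((B.corr_intS.trans κ.idPiX) x)) =
          (B.corr_intS.trans κ.idPiX) x :=
        MulEquiv.congr_fun hχ _
      rw [MulEquiv.symm_apply_apply, MulEquiv.trans_apply] at this
      rw [MulEquiv.trans_apply]
      exact this

/-- **Joint form**: the four sub-node clauses r2, r3, r4a, r4b of the printed definition of `(*bs-Gal)` are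
SIMULTANEOUSLY inhabited at every typed datum (at `κ := ofBsGal B`), while r4a ∧ r4b fails for some `κ` as
soon as the reference cyclotome has a non-identity automorphism — the kernel form of the VACUITY CAVEAT of
`MonoThetaProp13Sub` («the mathematical content of the cut lies in PINNING `κ`»).
[claim: Mochizuki2012, status: disputed] (IUTchII §1 Prop 1.3 (iii) proof, kurims p.27 l.5–7) -/
theorem subnodes_inhabited_and_not_forall (B : BsGalData Z) (φ : Z.muN ≃* Z.muN)
    (hφ : φ ≠ MulEquiv.refl _) :
    (∃ κ : ConventionalCyclotomes Z B Z.muN,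
        Cor110cNatural κ ∧ Rmk321Natural κ ∧ CorrMuNConventional κ ∧ CorrIntSConventional κ) ∧
      ¬ ∀ κ : ConventionalCyclotomes Z B Z.muN, CorrMuNConventional κ ∧ CorrIntSConventional κ := by
  refine ⟨⟨ConventionalCyclotomes.ofBsGal B, subnodes_ofBsGal B⟩, fun h => ?_⟩
  exact not_corrMuNConventional_regauge (ConventionalCyclotomes.ofBsGal B) (corrMuNConventional_ofBsGal B)
    φ hφ (h _).1

end Prop13Sub

/-! ## Example 3.2: the universal closure over the input interface is refuted -/

namespace TemperedThetaMonoids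

open Multiplicative

/-- **[IUTchII] Example 3.2 AS TYPED — universal closure REFUTED** (row F-2568): the `Prop`-structure
`Example32Statements F` does NOT hold for every input `F : TemperedFrobenioidThetaData P`. Junk datum:
`P` trivial, `K := ℤ` (multiplicatively), trivial conjugation action, units `O^× := ⊤`, `Θ := 1 ∈ ℤ`
(a non-torsion UNIT), base monoid `⊥`; then `Θ ∈ O^× ∩ Θ^{ℚ≥0}` is not torsion, so the «characteristic
splitting up to torsion» clause of Ex. 3.2 (i) fails. The printed situation has `Θ_v` a NON-unit
(it has poles along the special fibre), which is what abc-iut-L6-d3's `example32Statements_witness` /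
L6-t2's `example32Statements_of_val` instantiate; the row is therefore a hypothesis on the input datum
(rule R5: admissible at named instances), not a closed fact. [claim: Mochizuki2012, status: disputed]
(IUTchII §3 Ex 3.2 (i), kurims p.88) -/
theorem not_forall_example32Statements :
    ¬ ∀ (P : Type) [Group P] (F : TemperedFrobenioidThetaData.{0, 0} P), Example32Statements F := by
  intro h
  let F : TemperedFrobenioidThetaData.{0, 0} (Multiplicative ℤ) :=
    { K := CommGrpCat.of (Multiplicative ℤ)
      conj := 1
      units := ⊤
      theta := (ofAdd (1 : ℤ) : Multiplicative ℤ)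
      baseMonoid := ⊥ }
  have hs : IsSplittingUpToTorsion F.units (rootPowers (F.conj 1 F.theta)) := (h _ F).splitting 1
  have hθ : F.conj 1 F.theta = F.theta := by rw [map_one]; rfl
  rw [hθ] at hs
  have hmem : F.theta ∈ rootPowers F.theta := powers_le_rootPowers _ (Submonoid.mem_powers _)
  have hfin : IsOfFinOrder F.theta := hs.inter_torsion F.theta (Subgroup.mem_top _) hmem
  have hfin' : IsOfFinOrder (ofAdd (1 : ℤ) : Multiplicative ℤ) := hfin
  rw [isOfFinOrder_iff_pow_eq_one] at hfin'
  obtain ⟨n, hn, hpow⟩ := hfin'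
  rw [← ofAdd_nsmul, ofAdd_eq_one, nsmul_eq_mul, mul_one] at hpow
  omega

/-- **Both kernel events for F-2568 side by side**: the universal closure is refuted (above) AND the
structure is inhabited by non-degenerate data (abc-iut-L6-d3's `example32Statements_witness`: `Θ`
non-torsion, moved by the action, non-torsion units) — so the typed Ex. 3.2 is neither a tautology nor
vacuous: it is a condition on the input. [claim: Mochizuki2012, status: disputed] (IUTchII §3 Ex 3.2, kurims pp.88–89) -/
theorem example32Statements_schema :
    (¬ ∀ (P : Type) [Group P] (F : TemperedFrobenioidThetaData.{0, 0} P), Example32Statements F) ∧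
      ∃ F : TemperedFrobenioidThetaData.{0, 0} (Multiplicative ℤ),
        Example32Statements F ∧ ¬ IsOfFinOrder F.theta :=
  ⟨not_forall_example32Statements,
    let ⟨F, h1, h2, _, _⟩ := example32Statements_witness
    ⟨F, h1, h2⟩⟩

end TemperedThetaMonoids

end Literature.IUT.HodgeArakelov
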